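import Summits.AtomisticToContinuum.HydrodynamicLimit.Theses.CollisionIsometryCLT
import Summits.AtomisticToContinuum.HydrodynamicLimit.Theorems.AprioriBounds.Negative.AdmissibleKernel
import Summits.AtomisticToContinuum.HydrodynamicLimit.Theorems.AprioriBounds.Negative.BlockDensityAveraging
import Summits.AtomisticToContinuum.HydrodynamicLimit.Theorems.AprioriBounds.Negative.AprioriBoundsFalseOfPersistentVacuum
import Summits.AtomisticToContinuum.HydrodynamicLimit.Theses.StiffCollisionalRelaxation
import Literature.Analysis.FluidPDE.HardSpherePhaseSpaceProofs
import Literature.MathematicalPhysics.KineticTheory.HardSphereEulerProofs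
import Literature.Analysis.FluidPDE.HardSphereAlexander
import Literature.MathematicalPhysics.KineticTheory.HardSphereVirialIdentity
import Summits.AtomisticToContinuum.HydrodynamicLimit.Theorems.StiffCollisionalRelaxationAssemblyFields

/-!
# `MacroClosure` (stmt-AtomisticToContinuum-14670, route rev 11), negative knowledge 1: the rev-11
# items force a σ-uniform packing ceiling on every admissible classical hard-sphere-Euler solution

Standing disprover of the rev-11 crux `MacroClosure` (`CollisionalTransferLocality → AprioriBounds →
FastMomentRelaxation → HydrodynamicLimit`, the last being the UNGUARDED conjunct of 2026-08-15;
workfile `Cruxes/MacroClosure/Disproof.lean`).  §1 the ceiling `PackingCeilingOne` and the hypothesis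
`DenseExcursionPastOne`; §2–§4 Haar calculus on `𝕋³`, mollification near the identity, the
deterministic averaging lemma `exists_lt_blockDensity`, bumps; §5 HEADLINE
`packingCeilingOne_of_aprioriBounds_of_hydrodynamicLimit_unguarded` (the chamber `ρ̄σ³ ≤ 1` of
stmt-9519 (ii), claimed for EVERY `t > 0`, plus the unguarded conjunct force `ρ_t(x) σ³ ≤ 1` on
`[0, T) × 𝕋³` along every admissible classical solution — `DiluteSelfConsistency`, stmt-3091, frozen
at `η = 1`); §6 consequences: `packingCeilingOne_of_routeItems` / `…_of_closesBinders`, the NEGATIVE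
LEMMAS MODULO `H = DenseExcursionPastOne` (`ImplosionDichotomy` crux stmt-12586 at level `> 1`, not
constructible today) `macroClosure_false_of_denseExcursionPastOne(')`, and
`not_aprioriBounds_of_denseExcursionPastOne_of_hydrodynamicLimit_unguarded` (outer measure only).

MAINTENANCE RECORD (full-build repair 2026-08-17, dependency drift; mathematics unchanged).  Route
rev 12 (2026-08-16) retired `AprioriBounds` (stmt-9519) and `MacroClosure` (stmt-14670), re-filed
`FastMomentRelaxation` (stmt-9522, live in route `StiffCollisionalRelaxation`) and restated
`AdaptedWeightCLT` (stmt-12949 → 14868); the Statement `_root_.HydrodynamicLimit` was RE-TYPED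
2026-08-16 (D-0032) to the packing-guarded form, the old conjunct being
`Literature.MathematicalPhysics.KineticTheory.HydrodynamicLimit` (`HydrodynamicLimit.of_unguarded`).
The rev-11 texts are read from records (`Retired9519.AprioriBounds` of the sibling module
`AprioriBoundsFalseOfPersistentVacuum`; `Retired12949.AdaptedWeightCLT`, `Retired14670.MacroClosure`
in §0) and from the live `StiffCollisionalRelaxation.FastMomentRelaxation`; the two theorems whose
headers named `_root_.HydrodynamicLimit` are re-stated against the unguarded conjunct (suffix
`_unguarded`), the old names surviving as deprecated aliases (append-only: deprecate, don't mutate).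
-/

noncomputable section

open MeasureTheory Filter Set Topology
open scoped ENNReal

namespace Summit.AtomisticToContinuum.HydrodynamicLimit.Theorems
namespace MacroClosureNegative

open Literature.MathematicalPhysics.KineticTheory Literature.Analysis.FluidPDE
open Summit.AtomisticToContinuum.HydrodynamicLimit.Theses.CollisionIsometryCLT
  (CollisionalTransferLocality DiffuseBackwardInfluence)
open Summit.AtomisticToContinuum.HydrodynamicLimit.Theses.StiffCollisionalRelaxation (FastMomentRelaxation)
open Summit.AtomisticToContinuum.HydrodynamicLimit.Theorems.AprioriBoundsNegative.Retired9519 (AprioriBounds)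

/-! ## §0 Records of the retired rev-11 route declarations (maintenance 2026-08-17) -/
/-- **RECORD of the retired crux `AdaptedWeightCLT`, rev-11 form (stmt-AtomisticToContinuum-12949; ledger
signature verbatim)**; retired at rev 12 for the time-local stmt-14868 (exp-moment hypothesis under `∀ t`). -/
def Retired12949.AdaptedWeightCLT : Prop :=
  ∀ (a₀ θ₀ : (UnitAddTorus (Fin 3)) → ℝ) (u₀ : (UnitAddTorus (Fin 3)) → (EuclideanSpace ℝ (Fin 3))), Continuous a₀ → Continuous θ₀ → Continuous u₀ → (∀ x, 0 < a₀ x) → (∀ x, 0 < θ₀ x) → ∃ σ₀ : ℝ, 0 < σ₀ ∧ ∀ σ : ℝ, 0 < σ → σ < σ₀ → let M := fun (N : ℕ) (y : Literature.Analysis.FluidPDE.Config (N + 1) (Fin 3) (UnitAddTorus (Fin 3))) (Δ : ℝ) (W : Fin (N + 1) → EuclideanSpace ℝ (Fin 3)) => (let G := Literature.Analysis.FluidPDE.Torus.geometry (Fin 3); let ε : ℝ := Literature.MathematicalPhysics.KineticTheory.hsDiameter σ N; let pre := fun k : ℕ => (let zk := Literature.Analysis.FluidPDE.Alexander.stateAfter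 G ε y k; Literature.Analysis.FluidPDE.freeFlight G (Literature.Analysis.FluidPDE.Alexander.freeExitTime G ε zk).toReal zk); (List.range (Literature.Analysis.FluidPDE.Alexander.collisionCount G ε y Δ)).foldl (fun W' k => @dite (Fin (N + 1) → EuclideanSpace ℝ (Fin 3)) (Literature.Analysis.FluidPDE.Alexander.incomingPairs G ε (pre k)).Nonempty (Classical.propDecidable _) (fun h => fun i => (Literature.Analysis.FluidPDE.collidePair G h.some.1 h.some.2 (fun j => ((pre k j).1, W' j)) i).2) (fun _ => W')) W); let ipr := fun N y Δ => ((N + 1 : ℕ) : ℝ)⁻¹ * ∑ i : Fin (N + 1), ∑ k : Fin (N + 1), (∑ a : Fin 3, ‖M N y Δ (Pi.single k (EuclideanSpace.single a (1 : ℝ))) i‖ ^ 2) ^ 2; ∀ Φ : (N : ℕ) → Literature.Analysis.FluidPDE.HardSphereFlow (Literature.Analysis.FluidPDE.Torus.geometry (Fin 3)) (Literature.MathematicalPhysics.KineticTheory.hsDiameter σ N) (N + 1), (∀ Δ : ℕ → ℝ, (∀ N, 0 < Δ N) → Tendsto Δ atTop (𝓝 0) → Tendsto (fun N : ℕ =>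 Δ N * ((N + 1 : ℕ) : ℝ) ^ ((1 : ℝ) / 3)) atTop atTop → ∀ t : ℝ, 0 < t → Tendsto (fun N : ℕ => ∫⁻ z, ENNReal.ofReal (ipr N ((Φ N).flow (t - Δ N) z) (Δ N)) ∂(Literature.MathematicalPhysics.KineticTheory.localGibbsLaw σ a₀ u₀ θ₀ N (Φ N))) atTop (𝓝 0)) → (∀ t : ℝ, 0 < t → ∃ lam Cexp : ℝ, 0 < lam ∧ Tendsto (fun N : ℕ => Literature.MathematicalPhysics.KineticTheory.localGibbsLaw σ a₀ u₀ θ₀ N (Φ N) {z | Cexp < ∫ s in Icc 0 t, ∫ y, Real.exp (lam * ‖y.2‖ ^ 2) ∂(Literature.Analysis.FluidPDE.empiricalMeasure ((Φ N).flow s z))}) atTop (𝓝 0)) → ∀ (γ C : ℝ) (φ : ℕ → (UnitAddTorus (Fin 3)) → ℝ), 0 < γ → γ ≤ 1 / 15 → ((∀ N, Literature.Analysis.FunctionSpaces.Torus.IsSmooth (φ N)) ∧ (∀ N y, 0 ≤ φ N y) ∧ (∀ N, ∫ y, φ N y = 1) ∧ (∀ (N : ℕ) y, ((N : ℝ) +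 1) ^ (-γ) ≤ Literature.Analysis.FluidPDE.Torus.euclidDist y 0 → φ N y = 0) ∧ (∀ (N : ℕ) y, φ N y ≤ C * ((N : ℝ) + 1) ^ (3 * γ)) ∧ (∀ (N : ℕ) y, ‖Literature.Analysis.FunctionSpaces.Torus.gradient (φ N) y‖ ≤ C * ((N : ℝ) + 1) ^ (4 * γ))) → let ρb := fun (N : ℕ) (s : ℝ) z (x : UnitAddTorus (Fin 3)) => Literature.MathematicalPhysics.KineticTheory.empiricalDensityField ((Φ N).flow s z) (fun y => φ N (y - x)); let mb := fun (N : ℕ) (s : ℝ) z (x : UnitAddTorus (Fin 3)) => Literature.MathematicalPhysics.KineticTheory.empiricalMomentumField ((Φ N).flow s z) (fun y => φ N (y - x)); let ub := fun (N : ℕ) (s : ℝ) z (x : UnitAddTorus (Fin 3)) => (ρb N s z x)⁻¹ • mb N s z x; let D := fun (N : ℕ) (s : ℝ) z (x : UnitAddTorus (Fin 3)) (j k : Fin 3) => (∫ y, φ N (y.1 - x) * ((y.2 j - ub N s z x j) * (y.2 k - ub N s z x k)) ∂(Literature.Analysis.FluidPDE.empiricalMeasure ((Φ N).flow s z))) -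 (if j = k then (∑ l : Fin 3, ∫ y, φ N (y.1 - x) * (y.2 l - ub N s z x l) ^ 2 ∂(Literature.Analysis.FluidPDE.empiricalMeasure ((Φ N).flow s z))) / 3 else 0); let q := fun (N : ℕ) (s : ℝ) z (x : UnitAddTorus (Fin 3)) => ∫ y, (φ N (y.1 - x) * ‖y.2 - ub N s z x‖ ^ 2 / 2) • (y.2 - ub N s z x) ∂(Literature.Analysis.FluidPDE.empiricalMeasure ((Φ N).flow s z)); ∀ t : ℝ, 0 < t → ∀ δ : ℝ, 0 < δ → Tendsto (fun N : ℕ => Literature.MathematicalPhysics.KineticTheory.localGibbsLaw σ a₀ u₀ θ₀ N (Φ N) {z | δ < ∫ s in Icc 0 t, ∫ x, ((∑ j, ∑ k, D N s z x j k ^ 2) + ‖q N s z x‖ ^ 2)}) atTop (𝓝 0)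

/-- **RECORD of the retired crux `MacroClosure`, rev-11 form (stmt-AtomisticToContinuum-14670; verbatim but
for the conjunct, spelled as the Literature decl `_root_.HydrodynamicLimit` abbreviated until 2026-08-16).** -/
def Retired14670.MacroClosure : Prop :=
  CollisionalTransferLocality → AprioriBounds → FastMomentRelaxation →
    Literature.MathematicalPhysics.KineticTheory.HydrodynamicLimit

open Retired12949 (AdaptedWeightCLT)
open Retired14670 (MacroClosure)

/-! ## §1 The packing ceiling and the excursion hypothesis -/
/-- **σ-uniform packing ceiling at level `1`** along admissible classical hard-sphere-Euler
solutions (`DiluteSelfConsistency`, stmt-3091, is the same shape with `< η` for every `η > 0`). -/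
@[conjecture] def PackingCeilingOne : Prop :=
  ∀ (a₀ θ₀ : T3 → ℝ) (u₀ : T3 → V3), Continuous a₀ → Continuous θ₀ → Continuous u₀ →
    (∀ x, 0 < a₀ x) → (∀ x, 0 < θ₀ x) →
    ∃ σ₀ : ℝ, 0 < σ₀ ∧ ∀ σ : ℝ, 0 < σ → σ < σ₀ →
      ∀ (T : ℝ) (ρ θ : ℝ → T3 → ℝ) (u : ℝ → T3 → V3), IsHardSphereEulerSolution σ T ρ u θ →
        ∀ Φ : (N : ℕ) → HardSphereFlow (Torus.geometry (Fin 3)) (hsDiameter σ N) (N + 1),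
          TendstoHydroFieldsAt (fun N => localGibbsLaw σ a₀ u₀ θ₀ N (Φ N)) Φ ρ u θ 0 →
            ∀ t ∈ Ico 0 T, ∀ x, ρ t x * σ ^ 3 ≤ 1

/-- **Dense excursion past packing `1`** (hypothesis `H`, NOT constructible in the tree today): some
continuous positive profiles admit, at arbitrarily small `σ`, an admissible classical
hard-sphere-Euler solution whose packing exceeds `1` somewhere on its interval of classical
existence (the `ImplosionDichotomy` crux `DenseExcursion`, stmt-12586, at level `> 1`). -/
@[conjecture] def DenseExcursionPastOne : Prop :=
  ∃ (a₀ θ₀ : T3 → ℝ) (u₀ : T3 → V3), Continuous a₀ ∧ Continuous θ₀ ∧ Continuous u₀ ∧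
    (∀ x, 0 < a₀ x) ∧ (∀ x, 0 < θ₀ x) ∧
    ∀ σ₀ : ℝ, 0 < σ₀ → ∃ σ : ℝ, 0 < σ ∧ σ < σ₀ ∧
      ∃ (T : ℝ) (ρ θ : ℝ → T3 → ℝ) (u : ℝ → T3 → V3), IsHardSphereEulerSolution σ T ρ u θ ∧
        (∀ Φ : (N : ℕ) → HardSphereFlow (Torus.geometry (Fin 3)) (hsDiameter σ N) (N + 1),
          TendstoHydroFieldsAt (fun N => localGibbsLaw σ a₀ u₀ θ₀ N (Φ N)) Φ ρ u θ 0) ∧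
        ∃ t ∈ Ico 0 T, ∃ x, 1 < ρ t x * σ ^ 3

/-! ## §2 Haar calculus on `𝕋³` and mollification near the identity (the two elementary identities are
the landed lemmas; the local copies of 2026-08-16 survive as deprecated aliases, gate dedup 2026-08-17) -/

/-- `∫ φ(y - x) dx = ∫ φ` — deprecated local name of `MacroBookkeeping.integral_kernel_comp_sub_left`. -/
@[deprecated MacroBookkeeping.integral_kernel_comp_sub_left (since := "2026-08-17")]
alias integral_comp_sub_left := MacroBookkeeping.integral_kernel_comp_sub_left

/-- `euclidDist (y - x) 0 = euclidDist y x` — deprecated local name of the Literature lemma. -/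
@[deprecated Literature.MathematicalPhysics.KineticTheory.euclidDist_sub_zero (since := "2026-08-17")]
alias euclidDist_sub_zero := Literature.MathematicalPhysics.KineticTheory.euclidDist_sub_zero

/-- Uniform continuity on `𝕋³` in the minimal-image distance (compactness; Mathlib's sup distance is
dominated by `euclidDist`, `Torus.norm_sub_le_euclidDist_holds`). -/
theorem exists_forall_euclidDist_lt_abs_sub_lt {f : T3 → ℝ} (hf : Continuous f) {η : ℝ}
    (hη : 0 < η) : ∃ δ : ℝ, 0 < δ ∧ ∀ x y, Torus.euclidDist x y < δ → |f x - f y| < η := by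
  have hu : UniformContinuous f := CompactSpace.uniformContinuous_of_continuous hf
  obtain ⟨δ, hδ, hδf⟩ := Metric.uniformContinuous_iff.1 hu η hη
  refine ⟨δ, hδ, fun x y hxy => ?_⟩
  have hd : dist x y < δ := by
    rw [dist_eq_norm]; exact (Torus.norm_sub_le_euclidDist_holds x y).trans_lt hxy
  have := hδf hd
  rwa [Real.dist_eq] at this

/-- **Mollification is uniformly close to the identity**: for a continuous kernel `φ ≥ 0` of mass
`1` supported in the minimal-image ball of radius `r`, and `f` continuous with `|f y - f x| ≤ η`
whenever `euclidDist y x < r`, `|∫ f(x) φ(y - x) dx - f(y)| ≤ η` for every `y`. -/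
theorem abs_integral_mul_translate_sub_le {φ : T3 → ℝ} {r : ℝ} (hφc : Continuous φ)
    (hφ0 : ∀ y, 0 ≤ φ y) (hφ1 : ∫ y, φ y = 1) (hsupp : ∀ y, r ≤ Torus.euclidDist y 0 → φ y = 0)
    {f : T3 → ℝ} (hf : Continuous f) {η : ℝ}
    (hmod : ∀ x y, Torus.euclidDist y x < r → |f y - f x| ≤ η) (y : T3) :
    |(∫ x, f x * φ (y - x)) - f y| ≤ η := by
  have hφy : Continuous fun x => φ (y - x) := hφc.comp (continuous_const.sub continuous_id)
  have h1 : ∫ x, φ (y - x) = 1 := by rw [MacroBookkeeping.integral_kernel_comp_sub_left φ y, hφ1]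
  have hrepr : (∫ x, f x * φ (y - x)) - f y = ∫ x, φ (y - x) * (f x - f y) := by
    have hfy : f y = ∫ x, φ (y - x) * f y := by rw [integral_mul_const, h1, one_mul]
    calc (∫ x, f x * φ (y - x)) - f y = (∫ x, f x * φ (y - x)) - ∫ x, φ (y - x) * f y := by
          rw [← hfy]
      _ = ∫ x, φ (y - x) * (f x - f y) := by
          have hi1 : Integrable (fun x => f x * φ (y - x)) :=
            integrable_of_continuous_T3 (hf.mul hφy)
          have hi2 : Integrable (fun x => φ (y - x) * f y) :=
            integrable_of_continuous_T3 (hφy.mul continuous_const)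
          rw [← integral_sub hi1 hi2]
          refine integral_congr_ae (ae_of_all _ fun x => ?_)
          ring
  rw [hrepr]
  calc |∫ x, φ (y - x) * (f x - f y)| ≤ ∫ x, |φ (y - x) * (f x - f y)| := abs_integral_le_integral_abs
    _ ≤ ∫ x, φ (y - x) * η := by
        have hi1 : Integrable (fun x => φ (y - x) * (f x - f y)) :=
          integrable_of_continuous_T3 (hφy.mul (hf.sub continuous_const))
        have hi2 : Integrable (fun x => φ (y - x) * η) :=
          integrable_of_continuous_T3 (hφy.mul continuous_const)
        refine integral_mono hi1.abs hi2 fun x => ?_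
        dsimp only
        rw [abs_mul, abs_of_nonneg (hφ0 _)]
        by_cases hyx : Torus.euclidDist y x < r
        · have hxy : Torus.euclidDist x y < r := by rwa [Torus.euclidDist_comm]
          exact mul_le_mul_of_nonneg_left (hmod y x hxy) (hφ0 _)
        · have hz : φ (y - x) = 0 := hsupp _ (by
            rw [Literature.MathematicalPhysics.KineticTheory.euclidDist_sub_zero]; exact le_of_not_gt hyx)
          rw [hz, zero_mul, zero_mul]
    _ = η := by rw [integral_mul_const, h1, one_mul]

/-! ## §3 Deterministic averaging: a dense test function forces a dense block -/
/-- **A dense test function forces a dense block.**  Let `φ ≥ 0` be a continuous kernel of mass `1`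
supported in the minimal-image ball of radius `r`, and `χ ≥ 0` continuous with `|χ y - χ x| ≤ η`
whenever `euclidDist y x < r`.  If the empirical density field of a configuration `z` (`N ≠ 0`
particles) tested against `χ` exceeds `B ∫χ + η`, then SOME block `x ↦ (N)⁻¹∑ᵢ φ(xᵢ - x)` has
density `> B` (`∫ χ ρ̄ = N⁻¹ ∑ᵢ (χ ⋆ φ̌)(xᵢ) ≥ ⟨μ_z, χ⟩ - η`, while `ρ̄ ≤ B` would give `≤ B ∫χ`). -/
theorem exists_lt_blockDensity {N : ℕ} (hN : N ≠ 0) (z : Config N (Fin 3) T3)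
    {φ : T3 → ℝ} {r : ℝ} (hφc : Continuous φ) (hφ0 : ∀ y, 0 ≤ φ y) (hφ1 : ∫ y, φ y = 1)
    (hsupp : ∀ y, r ≤ Torus.euclidDist y 0 → φ y = 0)
    {χ : T3 → ℝ} (hχc : Continuous χ) (hχ0 : ∀ x, 0 ≤ χ x) {η : ℝ}
    (hmod : ∀ x y, Torus.euclidDist y x < r → |χ y - χ x| ≤ η)
    {B : ℝ} (h : B * (∫ x, χ x) + η < empiricalDensityField z χ) :
    ∃ x, B < empiricalDensityField z (fun y => φ (y - x)) := by
  by_contra hcon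
  push Not at hcon
  have hχi : Integrable χ := integrable_of_continuous_T3 hχc
  have hrw : (fun x => χ x * empiricalDensityField z (fun y => φ (y - x))) =
      fun x => (N : ℝ)⁻¹ * ∑ i, χ x * φ ((z i).1 - x) := by
    funext x
    rw [AprioriBoundsNegative.blockDensity_eq, ← Finset.mul_sum]
    ring
  have hci : ∀ i : Fin N, Continuous fun x => χ x * φ ((z i).1 - x) := fun i =>
    hχc.mul (hφc.comp (continuous_const.sub continuous_id))
  have hint : Integrable (fun x => χ x * empiricalDensityField z (fun y => φ (y - x))) := by
    rw [hrw]
    exact (integrable_finsetSum _ fun i _ => integrable_of_continuous_T3 (hci i)).const_mul _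
  have ha : ∫ x, χ x * empiricalDensityField z (fun y => φ (y - x)) ≤ B * ∫ x, χ x := by
    calc ∫ x, χ x * empiricalDensityField z (fun y => φ (y - x)) ≤ ∫ x, χ x * B :=
          integral_mono hint (hχi.mul_const B) fun x => mul_le_mul_of_nonneg_left (hcon x) (hχ0 x)
      _ = B * ∫ x, χ x := by rw [integral_mul_const, mul_comm]
  have hdens : empiricalDensityField z χ = (N : ℝ)⁻¹ * ∑ i, χ (z i).1 := by
    unfold empiricalDensityField
    rw [integral_empiricalMeasure]
  have hkey : ∀ i : Fin N, χ (z i).1 - η ≤ ∫ x, χ x * φ ((z i).1 - x) := fun i => by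
    have h2 := (abs_le.1 (abs_integral_mul_translate_sub_le hφc hφ0 hφ1 hsupp hχc hmod (z i).1)).1
    linarith
  have hb : empiricalDensityField z χ - η ≤ ∫ x, χ x * empiricalDensityField z (fun y => φ (y - x)) := by
    rw [hrw, integral_const_mul, integral_finsetSum _ fun i _ => integrable_of_continuous_T3 (hci i),
      hdens]
    have hsum : ∑ i : Fin N, (χ (z i).1 - η) ≤ ∑ i : Fin N, ∫ x, χ x * φ ((z i).1 - x) :=
      Finset.sum_le_sum fun i _ => hkey i
    rw [Finset.sum_sub_distrib, Finset.sum_const, Finset.card_univ, Fintype.card_fin,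
      nsmul_eq_mul] at hsum
    have hNpos : (0 : ℝ) < N := by exact_mod_cast Nat.pos_of_ne_zero hN
    have := mul_le_mul_of_nonneg_left hsum (inv_nonneg.2 hNpos.le)
    have hη : (N : ℝ)⁻¹ * ((N : ℝ) * η) = η := by rw [← mul_assoc, inv_mul_cancel₀ hNpos.ne', one_mul]
    calc (N : ℝ)⁻¹ * ∑ i, χ (z i).1 - η = (N : ℝ)⁻¹ * (∑ i, χ (z i).1 - (N : ℝ) * η) := by
          rw [mul_sub, hη]
      _ ≤ (N : ℝ)⁻¹ * ∑ i, ∫ x, χ x * φ ((z i).1 - x) := this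
  linarith

/-! ## §4 A bump around a point -/
/-- A continuous bump `χ ≥ 0` supported in an open set `U ∋ x₀`, with `∫ χ > 0` (Haar measure on
`𝕋³` charges open sets). -/
theorem exists_bump {U : Set T3} (hU : IsOpen U) {x₀ : T3} (hx₀ : x₀ ∈ U) :
    ∃ χ : T3 → ℝ, Continuous χ ∧ (∀ x, 0 ≤ χ x) ∧ (∀ x, x ∉ U → χ x = 0) ∧ 0 < ∫ x, χ x := by
  obtain ⟨r, hr, hball⟩ := Metric.isOpen_iff.1 hU x₀ hx₀
  have hc : Continuous fun y : T3 => max (r - dist y x₀) 0 :=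
    (continuous_const.sub (continuous_id.dist continuous_const)).max continuous_const
  refine ⟨fun y => max (r - dist y x₀) 0, hc, fun y => le_max_right _ _, fun y hy => ?_, ?_⟩
  · have hry : r ≤ dist y x₀ := by
      by_contra h; push Not at h; exact hy (hball (Metric.mem_ball.2 h))
    exact max_eq_right (by linarith)
  · refine hc.integral_pos_of_hasCompactSupport_nonneg_nonzero (x := x₀)
      (HasCompactSupport.of_support_subset_isCompact isCompact_univ (subset_univ _))
      (fun y => le_max_right _ _) ?_
    rw [dist_self, sub_zero, max_eq_left hr.le]
    exact hr.ne'

/-! ## §5 The packing ceiling from `AprioriBounds` and the conjunct -/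
/-- **HEADLINE.** `AprioriBounds → HydrodynamicLimit (unguarded conjunct of 2026-08-15) → PackingCeilingOne`:
the chamber `ρ̄σ³ ≤ 1` of stmt-9519 (ii) (every `t > 0`, every admissible kernel family) and the conjunct
keep every admissible classical hard-sphere-Euler solution at packing `≤ 1` on `[0, T)`, for all small `σ`.
(Re-statement 2026-08-17 of the landed headline, whose header named `_root_.HydrodynamicLimit`; proof verbatim.) -/
theorem packingCeilingOne_of_aprioriBounds_of_hydrodynamicLimit_unguarded (hAB : AprioriBounds)
    (hHL : Literature.MathematicalPhysics.KineticTheory.HydrodynamicLimit) : PackingCeilingOne := by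
  intro a₀ θ₀ u₀ ha hθ hu ha0 hθ0
  obtain ⟨σ₁, hσ₁, H1⟩ := hAB a₀ θ₀ u₀ ha hθ hu ha0 hθ0
  obtain ⟨σ₂, hσ₂, H2⟩ := hHL a₀ θ₀ u₀ ha hθ hu ha0 hθ0
  refine ⟨min (min σ₁ σ₂) (1 / 2), lt_min (lt_min hσ₁ hσ₂) (by norm_num), ?_⟩
  intro σ hσ hσlt T ρ θ u hsol Φ hLLN0 t ht x₀
  have hσ₁' : σ < σ₁ := lt_of_lt_of_le hσlt ((min_le_left _ _).trans (min_le_left _ _))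
  have hσ₂' : σ < σ₂ := lt_of_lt_of_le hσlt ((min_le_left _ _).trans (min_le_right _ _))
  have hσhalf : σ ≤ 1 / 2 := (lt_of_lt_of_le hσlt (min_le_right _ _)).le
  by_contra hx
  push Not at hx
  have hLLNt : TendstoHydroFieldsAt (fun N => localGibbsLaw σ a₀ u₀ θ₀ N (Φ N)) Φ ρ u θ t :=
    H2 σ hσ hσ₂' T ρ θ u hsol Φ hLLN0 t ht
  have hρc : Continuous (ρ t) := (hsol.smooth_density.isSmooth_slice ht).continuous
  have hs3 : 0 < σ ^ 3 := by positivity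
  set B : ℝ := (σ ^ 3)⁻¹ with hB
  have hBx : B < ρ t x₀ := by
    by_contra h; push Not at h; have := mul_le_mul_of_nonneg_right h hs3.le
    rw [hB, inv_mul_cancel₀ hs3.ne'] at this; linarith
  set gap : ℝ := ρ t x₀ - B with hgap
  have hgap0 : 0 < gap := by rw [hgap]; linarith
  set U : Set T3 := {y | B + gap / 2 < ρ t y} with hU
  have hUo : IsOpen U := isOpen_lt continuous_const hρc
  have hxU : x₀ ∈ U := by show B + gap / 2 < ρ t x₀; rw [hgap]; linarith
  obtain ⟨χ, hχc, hχ0, hχU, hm⟩ := exists_bump hUo hxU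
  set m : ℝ := ∫ x, χ x
  have hχi : Integrable χ := integrable_of_continuous_T3 hχc
  have hI : (B + gap / 2) * m ≤ ∫ x, χ x * ρ t x := by
    have hpt : ∀ x, χ x * (B + gap / 2) ≤ χ x * ρ t x := fun x => by
      by_cases hxU' : x ∈ U
      · exact mul_le_mul_of_nonneg_left (le_of_lt hxU') (hχ0 x)
      · rw [hχU x hxU', zero_mul, zero_mul]
    calc (B + gap / 2) * m = ∫ x, χ x * (B + gap / 2) := by rw [integral_mul_const, mul_comm]
      _ ≤ ∫ x, χ x * ρ t x :=
          integral_mono (hχi.mul_const _) (integrable_of_continuous_T3 (hχc.mul hρc)) hpt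
  set η : ℝ := gap * m / 8 with hηdef
  have hη : 0 < η := by positivity
  obtain ⟨δ', hδ', hmodχ⟩ := exists_forall_euclidDist_lt_abs_sub_lt hχc hη
  obtain ⟨γ, C, φ, hγ, hγ', hsm, hnn, hone, hsupp, hsup, hgrad, -⟩ :=
    AprioriBoundsNegative.exists_admissibleKernelFamily
  have ht1 : 0 < t + 1 := by linarith [ht.1]
  obtain ⟨c₁, -, hE⟩ := (H1 σ hσ hσ₁' Φ (t + 1) ht1).2 γ C φ hγ hγ' ⟨hsm, hnn, hone, hsupp, hsup, hgrad⟩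
  have hrad : Tendsto (fun N : ℕ => ((N : ℝ) + 1) ^ (-γ)) atTop (𝓝 0) :=
    (tendsto_rpow_neg_atTop hγ).comp (tendsto_atTop_add_const_right _ 1 tendsto_natCast_atTop_atTop)
  have hrad' : ∀ᶠ N : ℕ in atTop, ((N : ℝ) + 1) ^ (-γ) < δ' := (tendsto_order.1 hrad).2 δ' hδ'
  have hD := (hLLNt χ hχc η hη).1
  set P : (N : ℕ) → Measure (Config (N + 1) (Fin 3) T3) := fun N => localGibbsLaw σ a₀ u₀ θ₀ N (Φ N)
  set E : (N : ℕ) → Set (Config (N + 1) (Fin 3) T3) := fun N =>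
    {z | ∃ s ∈ Icc 0 (t + 1), ∃ x : T3,
      empiricalDensityField ((Φ N).flow s z) (fun y => φ N (y - x)) < c₁ ∨
        1 < empiricalDensityField ((Φ N).flow s z) (fun y => φ N (y - x)) * σ ^ 3}
  set D : (N : ℕ) → Set (Config (N + 1) (Fin 3) T3) := fun N =>
    {z | η < |empiricalDensityField ((Φ N).flow t z) χ - ∫ x, χ x * ρ t x|}
  have hE' : Tendsto (fun N => P N (E N)) atTop (𝓝 0) := hE
  have hD' : Tendsto (fun N => P N (D N)) atTop (𝓝 0) := hD
  have hsum : Tendsto (fun N => P N (E N) + P N (D N)) atTop (𝓝 0) := by simpa using hE'.add hD'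
  have hlt : ∀ᶠ N in atTop, P N (E N) + P N (D N) < 1 := (tendsto_order.1 hsum).2 1 zero_lt_one
  have hge : ∀ᶠ N in atTop, 1 ≤ P N (E N) + P N (D N) := by
    filter_upwards [hrad'] with N hN
    haveI : IsProbabilityMeasure (P N) :=
      isProbabilityMeasure_localGibbsLaw ha hθ hu ha0 hθ0 hσhalf N (Φ N)
    have hincl : (univ : Set (Config (N + 1) (Fin 3) T3)) ⊆ E N ∪ D N := by
      intro z _
      by_cases hz : η < |empiricalDensityField ((Φ N).flow t z) χ - ∫ x, χ x * ρ t x|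
      · exact Or.inr hz
      · left
        have hdev : (∫ x, χ x * ρ t x) - η ≤ empiricalDensityField ((Φ N).flow t z) χ := by
          have := (abs_le.1 (not_lt.1 hz)).1; linarith
        have hhyp : B * (∫ x, χ x) + η < empiricalDensityField ((Φ N).flow t z) χ := by
          have : B * m + η < (B + gap / 2) * m - η := by rw [hηdef]; nlinarith
          linarith
        have hmodN : ∀ x y, Torus.euclidDist y x < ((N : ℝ) + 1) ^ (-γ) → |χ y - χ x| ≤ η :=
          fun x y hxy => (hmodχ y x (hxy.trans hN)).le
        obtain ⟨x, hxB⟩ := exists_lt_blockDensity (Nat.succ_ne_zero N) ((Φ N).flow t z)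
          (hsm N).continuous (hnn N) (hone N) (hsupp N) hχc hχ0 hmodN hhyp
        refine ⟨t, ⟨ht.1, by linarith⟩, x, Or.inr ?_⟩
        have := mul_lt_mul_of_pos_right hxB hs3
        rwa [hB, inv_mul_cancel₀ hs3.ne'] at this
    calc (1 : ℝ≥0∞) = P N univ := measure_univ.symm
      _ ≤ P N (E N ∪ D N) := measure_mono hincl
      _ ≤ P N (E N) + P N (D N) := measure_union_le _ _
  obtain ⟨N, h1, h2⟩ := (hlt.and hge).exists
  exact absurd h2 (not_le.2 h1)

/-- Deprecated (header named `_root_.HydrodynamicLimit`, the unguarded conjunct until 2026-08-16). -/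
@[deprecated packingCeilingOne_of_aprioriBounds_of_hydrodynamicLimit_unguarded (since := "2026-08-17")]
alias packingCeilingOne_of_aprioriBounds_of_hydrodynamicLimit :=
  packingCeilingOne_of_aprioriBounds_of_hydrodynamicLimit_unguarded

/-! ## §6 Consequences for the rev-11 route and for the shared item `AprioriBounds` -/
/-- **Kinetic engine glue of route rev 11** (retired item stmt-AtomisticToContinuum-14177, `kineticEngineGlue_proof`
@ 98a28b57767c; re-proved on the records): feed `AdaptedWeightCLT` the rows bound and exp-moment (i). -/
theorem kineticEngineGlue_rev11 :
    DiffuseBackwardInfluence → AdaptedWeightCLT → AprioriBounds → FastMomentRelaxation := by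
  intro hD hC h₃ a₀ θ₀ u₀ ha hθ hu hapos hθpos
  obtain ⟨σ₁, hσ₁, H1⟩ := hD a₀ θ₀ u₀ ha hθ hu hapos hθpos
  obtain ⟨σ₂, hσ₂, H2⟩ := hC a₀ θ₀ u₀ ha hθ hu hapos hθpos
  obtain ⟨σ₃, hσ₃, H3⟩ := h₃ a₀ θ₀ u₀ ha hθ hu hapos hθpos
  refine ⟨min σ₁ (min σ₂ σ₃), lt_min hσ₁ (lt_min hσ₂ hσ₃), ?_⟩
  intro σ hσ hσlt Φ
  have h3 := H3 σ hσ (lt_of_lt_of_le hσlt ((min_le_right _ _).trans (min_le_right _ _))) Φ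
  intro γ C φ hγ hγ' hadm ρb mb ub D q t ht δ hδ
  exact H2 σ hσ (lt_of_lt_of_le hσlt ((min_le_right _ _).trans (min_le_left _ _))) Φ
    (H1 σ hσ (lt_of_lt_of_le hσlt (min_le_left _ _)) Φ) (fun s hs => (h3 s hs).1) γ C φ hγ hγ' hadm
    t ht δ hδ

/-- **The rev-11 route items prove the packing ceiling** (`MacroClosure` = record `Retired14670`). -/
theorem packingCeilingOne_of_routeItems (h₂ : CollisionalTransferLocality) (h₃ : AprioriBounds)
    (hF : FastMomentRelaxation) (hM : MacroClosure) : PackingCeilingOne :=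
  packingCeilingOne_of_aprioriBounds_of_hydrodynamicLimit_unguarded h₃ (hM h₂ h₃ hF)

/-- **Along the rev-11 deciding theorem** (`closes` rev 11 = `hM h₂ h₃ (glue hD hC h₃)`, inlined): its five
binders prove the ceiling — whatever closed that route also proved no-implosion-past-packing-1 for hs-Euler. -/
theorem packingCeilingOne_of_closesBinders (hD : DiffuseBackwardInfluence) (hC : AdaptedWeightCLT)
    (h₃ : AprioriBounds) (h₂ : CollisionalTransferLocality) (hM : MacroClosure) : PackingCeilingOne :=
  packingCeilingOne_of_aprioriBounds_of_hydrodynamicLimit_unguarded h₃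
    (hM h₂ h₃ (kineticEngineGlue_rev11 hD hC h₃))

/-- A packing ceiling at level `1` excludes any dense excursion past `1` (flows exist at every
`σ < 1/2` by Alexander's theorem, so the admissibility clause can be instantiated). -/
theorem not_denseExcursionPastOne_of_packingCeilingOne (hP : PackingCeilingOne) :
    ¬ DenseExcursionPastOne := by
  rintro ⟨a₀, θ₀, u₀, ha, hθ, hu, ha0, hθ0, H⟩
  obtain ⟨σ₀, hσ₀, HP⟩ := hP a₀ θ₀ u₀ ha hθ hu ha0 hθ0
  obtain ⟨σ, hσ, hσlt, T, ρ, θ, u, hsol, hLLN, t, ht, x, hx⟩ :=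
    H (min σ₀ (1 / 2)) (lt_min hσ₀ (by norm_num))
  have hσ₀' : σ < σ₀ := lt_of_lt_of_le hσlt (min_le_left _ _)
  have hσhalf : σ < 2⁻¹ := by have := lt_of_lt_of_le hσlt (min_le_right _ _); norm_num at this ⊢; exact this
  have hΦ : ∀ N : ℕ, Nonempty (HardSphereFlow (Torus.geometry (Fin 3)) (hsDiameter σ N) (N + 1)) :=
    fun N => HardSphereFlow.nonempty_torus_holds (hsDiameter_pos hσ N)
      ((hsDiameter_le hσ.le N).trans_lt hσhalf) (N + 1)
  let Φ : (N : ℕ) → HardSphereFlow (Torus.geometry (Fin 3)) (hsDiameter σ N) (N + 1) :=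
    fun N => (hΦ N).some
  have := HP σ hσ hσ₀' T ρ θ u hsol Φ (hLLN Φ) t ht x
  linarith

/-- **Negative lemma modulo `H = DenseExcursionPastOne`** (H not constructible here): under `H` the rev-11
crux `MacroClosure` (record `Retired14670`) is FALSE once its own three hypotheses hold (inconsistency). -/
theorem macroClosure_false_of_denseExcursionPastOne (hH : DenseExcursionPastOne)
    (h₂ : CollisionalTransferLocality) (h₃ : AprioriBounds) (hF : FastMomentRelaxation) :
    ¬ MacroClosure := fun hM =>
  not_denseExcursionPastOne_of_packingCeilingOne (packingCeilingOne_of_routeItems h₂ h₃ hF hM) hH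

/-- **Negative lemma modulo `H`, deciding-theorem form**: under `DenseExcursionPastOne` the crux is
false as soon as the other four binders of the rev-11 `closes` hold. -/
theorem macroClosure_false_of_denseExcursionPastOne' (hH : DenseExcursionPastOne)
    (hD : DiffuseBackwardInfluence) (hC : AdaptedWeightCLT) (h₃ : AprioriBounds)
    (h₂ : CollisionalTransferLocality) : ¬ MacroClosure := fun hM =>
  not_denseExcursionPastOne_of_packingCeilingOne (packingCeilingOne_of_closesBinders hD hC h₃ h₂ hM) hH

/-- **The shared item against the summit.**  Under `H = DenseExcursionPastOne`, the shared a-priori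
bound `AprioriBounds` (stmt-9519, wanted by `CollisionIsometryCLT` and `StiffCollisionalRelaxation`)
REFUTES the unguarded conjunct `Literature.MathematicalPhysics.KineticTheory.HydrodynamicLimit` (and vice versa). -/
theorem not_aprioriBounds_of_denseExcursionPastOne_of_hydrodynamicLimit_unguarded
    (hH : DenseExcursionPastOne) (hHL : Literature.MathematicalPhysics.KineticTheory.HydrodynamicLimit) :
    ¬ AprioriBounds := fun hAB =>
  not_denseExcursionPastOne_of_packingCeilingOne
    (packingCeilingOne_of_aprioriBounds_of_hydrodynamicLimit_unguarded hAB hHL) hH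

/-- Deprecated (header named `_root_.HydrodynamicLimit`, the unguarded conjunct until 2026-08-16). -/
@[deprecated not_aprioriBounds_of_denseExcursionPastOne_of_hydrodynamicLimit_unguarded (since := "2026-08-17")]
alias not_aprioriBounds_of_denseExcursionPastOne_of_hydrodynamicLimit :=
  not_aprioriBounds_of_denseExcursionPastOne_of_hydrodynamicLimit_unguarded
end MacroClosureNegative
end Summit.AtomisticToContinuum.HydrodynamicLimit.Theorems
end
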